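import Summits.BirchSwinnertonDyer.BirchSwinnertonDyer.Theorems.PrintCFramBottomClassIndexLawFiveLeGenusInternalStrippedIdentityRoadThirteen
import Summits.BirchSwinnertonDyer.BirchSwinnertonDyer.Theorems.PrintCFramBottomClassIndexLawFiveLeKrizLiBindersKroneckerField
import Summits.BirchSwinnertonDyer.BirchSwinnertonDyer.Theorems.PrintCFramBottomClassIndexLawFiveLeKrizLiBindersKroneckerOdd
import Literature.NumberTheory.QuadraticFields.KroneckerSplitting
import Mathlib.Tactic.NormNum.LegendreSymbol
import HarnessLib

/-!
# Route `PrintCFram`, crux C2 `BottomClassIndexLawFiveLe` (stmt-BirchSwinnertonDyer-20372), line `eisenstein-resource-bdp-line`: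
# (GI-S, file 3) THE WINDOW CLASS `e* = −39 = (−3)·13` AT `p = 7` IN REGISTRY CURRENCY — the Heegner hypothesis of the
# stripping field `ℚ(√−3)` for `N(49a1^{(13)})` and the Kronecker values `ε_K = (·|3)` in the kernel; END STATE for `49a1^{(−39)}`

Cell `bsd-print-cfram`, width seat `bsd-line-cfram-p1-w7` g8 (prover); helper `--supports` stmt-BirchSwinnertonDyer-20372; THEOREMS ONLY
(0 definitions, 0 named facts, 0 `sorry`); nothing registered is touched. BSD is not proved by any of this; no summit statement is proved by
this seat; no registered stub is closed.

WHAT. Files 1–2 (p705925, `…StrippedIdentityRoadThirteen`) give `BSDp W 7` for the rank-one twists `W ≅ V^{(d_K)}`, `V ∼ 49a1^{(13)}`,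
over any imaginary quadratic `K` in which `7` and `13` split, from the regularity of the rank-one class `((·|13)·ε_K)~` (co-regularity
of `13` discharged). LEAD g13 §4's `p = 7` window class `e* = −39` is the stripping `D = −3`, `f = 13` (ideator g20, w8 g9 (c)). This file
removes the two field-side binders for `K = ℚ(√−3)`:

* §1 `satisfiesHeegnerHypothesis_of_smul_eq_twist_cm7_thirteen` — for `V ∼ 49a1^{(13)}` of conductor `N`, the Heegner hypothesis for
  `N` in `K` IS «`7` and `13` split in `K`» (the bad primes of `V` are `7`, `13`: file 2 §1's good reduction off `7·13` and
  `dvd_conductorNorm_iff_not_hasGoodReductionAtPrime`); `…_of_discr_eq_neg_three` — both split in the field of discriminant `−3`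
  (`Quadratic.ncard_primesOver_eq_two_iff_legendreSym`: `(−3/7) = (−3/13) = 1`, `2² ≡ −3 (7)`, `6² ≡ −3 (13)`).
* §2 `kronecker_apply_eq_jacobiSym_three_of_discr_eq_neg_three` — for `d_K = −3` the Kronecker character of Kriz–Li's binders takes the
  values `ε_K(ℓ) = (ℓ|3)` at every prime `ℓ ≠ 3` (w3 g2's decomposition law `KrizLiBinders.kroneckerValue_of_discr_eq_neg` at `m = 3`).
* §3 `bsdp_twist_cm7_neg39_identityRoad` — **END STATE FOR THE CLASS `−39` IN REGISTRY CURRENCY**: for every globally minimal `W` with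
  `C • W = 49a1^{(−39)}` and `ord_{s=1} L(W,s) = 1`, **`BSDp W 7`**, from: the class datum's REGULARITY exactly as `stub_seedOffExc` binds it
  (`χ` mod `m = 39` with values `(a|39)`, `k = 2`: `¬ ‖((7−2:ℕ):ℚ₇)⁻¹·B_{7−2,χ}‖ ≤ 7⁻¹`), an imaginary quadratic `K` with `d_K = −3` and
  its Kronecker character, a globally minimal model `V` of `49a1^{(13)}` of conductor `N` with a level-`N` parametrisation datum `Dt`,
  `7 ∤ c(Dt)`, Heegner data `(H, ι, P)` and `ιp : K → ℚ₇`, and the named facts Kriz–Li Thm. 1.20, GZ + Kolyvagin at `(N, V, K)`, GZK,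
  modularity, GZ I.(7.3), Cassels–Tate, Burungale–Flach Cor. 2. The dictionary `(ℓ|39) = (ℓ|13)·ε_K(ℓ)` (`jacobiSym.mul_right`, §2) feeds
  file 2's `hval`; the Heegner hypothesis is §1; co-regularity of `13` is file 2's `coregular_thirteen`.

HONEST FRAMING: per-class bookkeeping for ONE window class; what stays displayed is the Manin datum at level `N(49a1^{(13)})` (table
citation, as for the `cm7` identity road), the Heegner/parametrisation data and the named facts; the class's regularity is the stub's own
hypothesis. Nothing registered is touched; whether `−39` leaves `stub_seedOffExc` by a carve-out is the LEAD's call. beyond-print theorem: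
NO. References: [KrizLi2019] Thm. 1.20, §2; [Cox2013] §1.C Lemma 1.14, (1.18); [Marcus1977] Ch. 3 Thm. 25; [GrossZagier1986] I.(6.3);
crux STATUS w8 g9 06:50:20Z (c), LEAD g14 06:58:09Z, ideator `Ideas/genus-internal-heegner-fields.md` (−39 «stripping, display variant owed»).
-/

set_option autoImplicit false
-- `…BirchSwinnertonDyer.BirchSwinnertonDyer.Theorems…` is the problem's mandated namespace (D-0017).
set_option linter.dupNamespace false

noncomputable section

open scoped Classical NumberTheorySymbols

open WeierstrassCurve NumberField DirichletCharacter
  Literature.NumberTheory.EllipticCurves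
  Literature.NumberTheory.EllipticCurves.ModularForms
  Literature.NumberTheory.EllipticCurves.KrizLi2019
  Literature.NumberTheory.LFunctions
  Literature.NumberTheory.EllipticCurves.Rank1Residual
  Literature.NumberTheory.EllipticCurves.Rank1Residual.Typed
  Literature.NumberTheory.QuadraticFields
  Summit.BirchSwinnertonDyer.Rank1Residual
  Summit.BirchSwinnertonDyer.Rank1Residual.X12.O11
  Summit.BirchSwinnertonDyer.BirchSwinnertonDyer.Theorems
  Summit.BirchSwinnertonDyer.BirchSwinnertonDyer.Theorems.PrintCFram

namespace Summit.BirchSwinnertonDyer.BirchSwinnertonDyer.Theorems.PrintCFram.GenusInternal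

/-! ## §1. The Heegner hypothesis of the stripping field for `N(49a1^{(13)})` -/

/-- **Heegner hypothesis for `N(49a1^{(13)})` = «`7` and `13` split».** For an elliptic `V` with `C • V = cm7^{(13)}` of conductor `N`
and any number field `K`: if `7` and `13` split in `K` then `K` satisfies the Heegner hypothesis for `N` — a prime `q ∣ N` is a prime of
bad reduction (`dvd_conductorNorm_iff_not_hasGoodReductionAtPrime`), and `V` is good off `{7, 13}` (file 2 §1).
[cite: GrossZagier1986, I.§1 (Heegner hypothesis)] [cite: SilvermanAEC2009, X.5 Prop. 5.4] -/
theorem satisfiesHeegnerHypothesis_of_smul_eq_twist_cm7_thirteen (V : WeierstrassCurve ℚ) [V.IsElliptic]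
    (hV : ∃ C : VariableChange ℚ, C • V = cm7.quadraticTwist ((13 : ℤ) : ℚ))
    {N : ℕ} (hN : V.conductorNorm ℤ = N) (K : Type) [Field K] [NumberField K]
    (h7 : ((Ideal.span {((7 : ℕ) : ℤ)}).primesOver (𝓞 K)).ncard = 2)
    (h13 : ((Ideal.span {((13 : ℕ) : ℤ)}).primesOver (𝓞 K)).ncard = 2) :
    SatisfiesHeegnerHypothesis N K := by
  obtain ⟨-, -, -, -, -, hgood⟩ := classDatum_of_smul_eq_twist_cm7_thirteen V hV
  intro q hq hqN
  by_cases hq7 : q = 7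
  · subst hq7; exact h7
  by_cases hq13 : q = 13
  · subst hq13; exact h13
  exfalso
  haveI := Fact.mk hq
  have hbad : ¬ V.HasGoodReductionAtPrime q := (V.dvd_conductorNorm_iff_not_hasGoodReductionAtPrime q).mp (by rw [hN]; exact hqN)
  exact hbad (hgood q hq hq7 (fun h => hq13 ((Nat.prime_dvd_prime_iff_eq hq (by norm_num)).mp h)))

/-- **`7` and `13` split in the field of discriminant `−3`**, hence `K = ℚ(√−3)` satisfies the Heegner hypothesis for `N(49a1^{(13)})`:
`(−3/7) = 1` (`2² ≡ −3`) and `(−3/13) = 1` (`6² ≡ −3`), decomposition law `Quadratic.ncard_primesOver_eq_two_iff_legendreSym`.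
[cite: Marcus1977, Ch. 3 Thm. 25] [cite: Cox2013, §1.C (1.18)] -/
theorem satisfiesHeegnerHypothesis_of_smul_eq_twist_cm7_thirteen_of_discr_eq_neg_three (V : WeierstrassCurve ℚ) [V.IsElliptic]
    (hV : ∃ C : VariableChange ℚ, C • V = cm7.quadraticTwist ((13 : ℤ) : ℚ))
    {N : ℕ} (hN : V.conductorNorm ℤ = N) (K : Type) [Field K] [NumberField K] (hK : IsImaginaryQuadratic K)
    (hd : NumberField.discr K = -3) : SatisfiesHeegnerHypothesis N K := by
  haveI : Fact (Nat.Prime 7) := ⟨by norm_num⟩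
  haveI : Fact (Nat.Prime 13) := ⟨by norm_num⟩
  refine satisfiesHeegnerHypothesis_of_smul_eq_twist_cm7_thirteen V hV hN K ?_ ?_
  · rw [Quadratic.ncard_primesOver_eq_two_iff_legendreSym hK.1 (by norm_num), hd]
    norm_num
  · rw [Quadratic.ncard_primesOver_eq_two_iff_legendreSym hK.1 (by norm_num), hd]
    norm_num

/-! ## §2. The Kronecker character of `ℚ(√−3)`: `ε_K(ℓ) = (ℓ|3)` -/

/-- **`ε_K(ℓ) = (ℓ|3)` at every prime `ℓ ≠ 3` for `d_K = −3`.** The Kronecker character of Kriz–Li's binders is determined by splitting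
(`IsKroneckerCharacterOf`), and the splitting of `ℓ` in the field of discriminant `−3` is read on `(ℓ|3)` by w3 g2's decomposition law
`KrizLiBinders.kroneckerValue_of_discr_eq_neg` (`m = 3 ≡ 3 (mod 4)`, applied to the Jacobi character mod `3` of
`KrizLiBinders.exists_jacobiCharPadic`). [cite: Cox2013, §1.C Lemma 1.14 and (1.18)] [cite: KrizLi2019, §2 (p. 12, ε_K)] -/
theorem kronecker_apply_eq_jacobiSym_three_of_discr_eq_neg_three {p : ℕ} [Fact p.Prime]
    (K : Type) [Field K] [NumberField K] (hK : IsImaginaryQuadratic K) (hd : NumberField.discr K = -3)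
    (εK : DirichletCharacter ℚ_[p] (NumberField.discr K).natAbs) (hεK : IsKroneckerCharacterOf K εK)
    (ℓ : ℕ) (hℓ : ℓ.Prime) (hℓ3 : ℓ ≠ 3) :
    εK (ℓ : ZMod (NumberField.discr K).natAbs) = ((J((ℓ : ℤ) | 3) : ℤ) : ℚ_[p]) := by
  haveI : NeZero (3 : ℕ) := ⟨by norm_num⟩
  have hnd : ¬ ((ℓ : ℤ) ∣ NumberField.discr K) := by
    rw [hd, dvd_neg]
    intro h
    exact hℓ3 ((Nat.prime_dvd_prime_iff_eq hℓ Nat.prime_three).mp (by exact_mod_cast h))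
  obtain ⟨κ, hκ⟩ := KrizLiBinders.exists_jacobiCharPadic (p := p) 3
  rw [hεK.2 ℓ hℓ hnd, ← KrizLiBinders.kroneckerValue_of_discr_eq_neg hK.1 (m := 3) (by norm_num)
    (by rw [hd]; norm_num) κ hκ ℓ hℓ hnd, hκ ℓ]

/-! ## §3. END STATE for the class `e* = −39` in registry currency -/

/-- **`BSD(W,7)` FOR EVERY RANK-ONE MINIMAL MODEL OF `49a1^{(−39)}`, BY THE STRIPPED IDENTITY ROAD THROUGH `ℚ(√−3)`.** Data: the
class datum of `e* = −39` in the currency of `stub_seedOffExc` — a `ℚ₇`-valued character `χ` mod `39` with values `(a|39)` which is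
REGULAR at `k = 2`, `¬ ‖((7−2:ℕ):ℚ₇)⁻¹·B_{7−2,χ}‖_7 ≤ 7⁻¹`; an imaginary quadratic `K` with `d_K = −3` and its Kronecker character `ε_K`;
a globally minimal model `V` of `49a1^{(13)}` of conductor `N` with a level-`N` parametrisation datum `Dt`, `7 ∤ c(Dt)`, Heegner data
`(H, ι, P)`, `ιp : K → ℚ₇`; the named facts Kriz–Li Thm. 1.20, Gross–Zagier and Kolyvagin at `(N, V, K)`, GZK, modularity, GZ I.(7.3),
Cassels–Tate, Burungale–Flach Cor. 2. Conclusion: **`BSDp W 7`** for every globally minimal `W` with `C • W = cm7^{(−39)}` and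
`ord_{s=1} L(W,s) = 1`. Proof: file 2's `bsdp_of_smul_eq_twist_cm7_thirteen_mul_discr_identityRoad` (`13·d_K = −39`) with the Heegner
hypothesis of §1, `χε := χ` (primitive: `KrizLiBinders.isPrimitive_of_forall_eq_jacobiSym`, `39` odd squarefree) and the dictionary
`(ℓ|39) = (ℓ|13)·ε_K(ℓ)` (`jacobiSym.mul_right`, §2) off `N₁ = 39`. CONDITIONAL on the named facts and the displayed data; closes no
stub; the class's regularity is a HYPOTHESIS (the regular branch of the registry). [cite: KrizLi2019, Thm. 1.20 (pp. 7–8), §2 (p. 12)]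
[cite: GrossZagier1986, Thm. I.(6.3) and I.(7.3)] [cite: Cassels1962ArithmeticIV] [cite: BurungaleFlach2024, Cor. 2] [cite: Miller2011LMS, Def. 1.1]
[cite: Cox2013, §1.C Lemma 1.14] -/
theorem bsdp_twist_cm7_neg39_identityRoad
    (hKL : thm120_padicLogHeegner_unit_of_bernoulli)
    (hCT : exists_casselsTate_pairing (K := ℚ)) (hGZK : rank_eq_analyticRank_of_analyticRank_le_one)
    (hmod : hasEntireLFunction_rat) (hGZ73 : GrossZagier1986_thm_I_7_3) (hBF : bsdTriple_of_hasCM_of_L_one_ne_zero)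
    -- the class datum of `e* = −39` (registry currency: `m = 39`, `χ = (·|39)`, `k = 2`) and its REGULARITY
    (χ : DirichletCharacter ℚ_[7] 39) (hχ : ∀ a : ℕ, χ (a : ZMod 39) = ((J((a : ℤ) | 39) : ℤ) : ℚ_[7]))
    (hreg : ¬ ‖((7 - 2 : ℕ) : ℚ_[7])⁻¹ * generalizedBernoulli (7 - 2) χ‖ ≤ ((7 : ℕ) : ℝ)⁻¹)
    -- the stripping field `ℚ(√−3)` and the base `49a1^{(13)}` with its parametrisation / Heegner data
    (K : Type) [Field K] [NumberField K] (hK : IsImaginaryQuadratic K) (hd : NumberField.discr K = -3)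
    (εK : DirichletCharacter ℚ_[7] (NumberField.discr K).natAbs) (hεK : IsKroneckerCharacterOf K εK)
    (V : WeierstrassCurve ℚ) [V.IsElliptic] [V.IsGloballyMinimal]
    (hV : ∃ C : VariableChange ℚ, C • V = cm7.quadraticTwist ((13 : ℤ) : ℚ))
    {N : ℕ} [NeZero N] (hN : V.conductorNorm ℤ = N)
    (hGZ : gross_zagier N V K) (hKo : kolyvagin N V K)
    (Dt : ModularParametrizationData V N) (H : HeegnerDatum N (NumberField.discr K)) (ι : K →+* ℂ) (ιp : K →+* ℚ_[7])
    (P : (V.baseChange K).toAffine.Point)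
    (hP : WeierstrassCurve.Affine.Point.map ι.toRatAlgHom P = heegnerPointComplex Dt H)
    (hc : ¬ (7 : ℤ) ∣ Dt.c)
    -- the rank-one member
    (W : WeierstrassCurve ℚ) [W.IsElliptic] [W.IsGloballyMinimal]
    (hW : ∃ C : VariableChange ℚ, C • W = cm7.quadraticTwist ((-39 : ℤ) : ℚ)) (hr : W.analyticRank = 1) :
    BSDp W 7 := by
  haveI : NeZero (39 : ℕ) := ⟨by norm_num⟩
  have hHN : SatisfiesHeegnerHypothesis N K :=
    satisfiesHeegnerHypothesis_of_smul_eq_twist_cm7_thirteen_of_discr_eq_neg_three V hV hN K hK hd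
  have hχprim : χ.IsPrimitive :=
    KrizLiBinders.isPrimitive_of_forall_eq_jacobiSym hχ (by decide) (by
      rw [show (39 : ℕ) = 3 * 13 by norm_num]
      exact Nat.squarefree_mul_iff.mpr ⟨by norm_num, Nat.prime_three.squarefree, (by norm_num : Nat.Prime 13).squarefree⟩)
  -- the dictionary `(ℓ|39) = (ℓ|13)·ε_K(ℓ)` at the primes `ℓ ∤ 39`
  have hval : ∀ ℓ : ℕ, ℓ.Prime → ¬ ℓ ∣ 39 →
      χ (ℓ : ZMod 39) = ((J((ℓ : ℤ) | 13) : ℤ) : ℚ_[7]) * εK (ℓ : ZMod (NumberField.discr K).natAbs) := by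
    intro ℓ hℓ hℓ39
    have hℓ3 : ℓ ≠ 3 := by rintro rfl; exact hℓ39 (by norm_num)
    rw [hχ ℓ, kronecker_apply_eq_jacobiSym_three_of_discr_eq_neg_three K hK hd εK hεK ℓ hℓ hℓ3,
      show (39 : ℕ) = 13 * 3 by norm_num, jacobiSym.mul_right' (ℓ : ℤ) (by norm_num) (by norm_num), Int.cast_mul]
  have hreg' : ¬ ‖(5 : ℚ_[7])⁻¹ * generalizedBernoulli 5 χ‖ ≤ (7 : ℝ)⁻¹ := by
    simpa using hreg
  have hW' : ∃ C : VariableChange ℚ, C • W = cm7.quadraticTwist ((13 : ℤ) * NumberField.discr K : ℚ) := by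
    rw [hd]; norm_num; exact_mod_cast hW
  exact bsdp_of_smul_eq_twist_cm7_thirteen_mul_discr_identityRoad hKL hCT hGZK hmod hGZ73 hBF V hV hN K hK hHN hGZ hKo Dt H ι ιp
    P hP hc εK hεK (by norm_num) χ hχprim (N₁ := 39) (by norm_num) hval hreg' W hW' hr

end Summit.BirchSwinnertonDyer.BirchSwinnertonDyer.Theorems.PrintCFram.GenusInternal

end
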